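import Mathlib.Analysis.SpecialFunctions.Exponential
import Mathlib.Analysis.Calculus.Deriv.Mul
import Mathlib.Analysis.Calculus.Deriv.Slope
import Mathlib.Topology.Algebra.Module.FiniteDimension
import Literature.MathematicalPhysics.QuantumLattice.LatticeWilsonFlow
import Literature.MathematicalPhysics.QuantumLattice.TraceInequalitiesProofs
import Literature.MathematicalPhysics.QuantumFieldTheory.YangMillsOS
import Literature.NumberTheory.Automorphic.RealMatrixGroups
import HarnessLib

/-!
# The Lie algebra of a compact matrix group and of a lattice representation `r : LatticeRep G`

Topic `Literature/MathematicalPhysics/QuantumLattice` (definition request `defn-repLieAlgebra`,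
wanted by route `EquipartitionCriticality` of `QuantumFields/YangMills`, crux
`FreeEnergyLogCoefficient`: the equipartition count `(d−1)·dim G/2` of Gaussian modes per site in
Chatterjee-type free-energy asymptotics needs `dim G` for a compact simple `G` presented through a
faithful unitary matrix representation `r`).

**Source (read at the cited pages).** B. C. Hall, *Lie Groups, Lie Algebras, and Representations*,
2nd ed., GTM 222 (2015) [Hall2015]: Definition 3.18 (the Lie algebra of a matrix Lie group `G` is
`𝔤 = {X | e^{tX} ∈ G for all real t}`), Theorem 3.20 (for `X, Y ∈ 𝔤` and `A ∈ G`: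
`AXA⁻¹ ∈ 𝔤`, `sX ∈ 𝔤`, `X + Y ∈ 𝔤`, `XY − YX ∈ 𝔤` — proved with the Lie product formula and
`d/dt (e^{tX} Y e^{−tX})|₀ = XY − YX`, using that a real subspace of `M_n(ℂ)` is closed),
Proposition 3.24 (`𝔲(n)` = skew-Hermitian matrices, `𝔰𝔲(n)` = traceless skew-Hermitian ones);
T. Bröcker, T. tom Dieck, *Representations of Compact Lie Groups* (1985) [BrockerTomDieck1985],
I (2.16), (2.18) (`dim U(n) = n²`; `𝔰𝔲(n)`).

## What is here (everything stated is proved; the only new definitions are `matrixLieSubalgebra`,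
`repLieAlgebra`, `repLieSubalgebra`)

The tree already has the SET `oneParamGenerators H = {X | ∀ t : ℝ, exp (t • X) ∈ H}` and its real
span `matrixLieAlgebra H : Submodule ℝ (Matrix n n ℂ)` (`LatticeWilsonFlow.lean`, where the
closed-subgroup theorem was deliberately left out). This file supplies that theorem, in Hall's
elementary form, for a closed submonoid `H ⊆ M_n(ℂ)` (`1 ∈ H`, `H · H ⊆ H`, `H` closed):

* `add_mem_oneParamGenerators` (Lie product formula, tree `lieTrotter_productFormula_holds`),
  `conj_mem_oneParamGenerators` (`Ad`-stability), `mul_sub_mul_mem_matrixLieAlgebra` (the bracket,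
  by differentiating `t ↦ e^{tX} Y e^{−tX}` at `0` inside the closed subspace `matrixLieAlgebra H`);
* `coe_matrixLieAlgebra_eq` : `↑(matrixLieAlgebra H) = oneParamGenerators H` — the span IS the set
  (Hall, Thm. 3.20 (2)–(3)), `mem_matrixLieAlgebra_iff`, and the bundled real Lie subalgebra
  `matrixLieSubalgebra H … : LieSubalgebra ℝ (Matrix n n ℂ)` (bracket `XY − YX`);
* `star_eq_neg_of_mem_oneParamGenerators`, `matrixLieAlgebra_le_skewAdjoint` : inside `U(n)` the
  Lie algebra consists of skew-Hermitian matrices (Hall, Prop. 3.24, first half; the generator of a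
  one-parameter group is unique, `eq_of_forall_exp_smul_eq`);
* for a lattice representation `r : LatticeRep G` of a compact group (tree `YangMillsOS.lean`):
  `repLieAlgebra r := matrixLieAlgebra (Set.range r.ρ)`, DEFINITIONALLY the inline
  `Submodule.span ℝ {X | ∀ t : ℝ, exp ((t : ℂ) • X) ∈ Set.range r.ρ}` of the route
  (`span_eq_repLieAlgebra`, `finrank_span_eq_finrank_repLieAlgebra`, both `rfl`), with
  `mem_repLieAlgebra_iff` (membership = generating a one-parameter subgroup of `r(G)`),
  `conj_mem_repLieAlgebra` (`Ad r(g)`-stability), `repLieAlgebra_le_skewAdjoint`, the Lie subalgebra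
  `repLieSubalgebra r ≤ skewHermitianLie ℂ (Fin r.N)` (tree `𝔲(N)` of `RealMatrixGroups.lean`).

The identifications `matrixLieAlgebra U(n) = 𝔲(n)`, `matrixLieAlgebra SU(n) = 𝔰𝔲(n)` and the
dimension counts `n²`, `n² − 1` (Hall Prop. 3.24, Bröcker–tom Dieck I (2.16), (2.18)) are in the
sibling file `RepLieAlgebraUnitary.lean`.

## Design notes

* No matrix norm is global: the two analytic steps (`hasDerivAt_conj_exp_smul`,
  `eq_of_forall_exp_smul_eq`) run in Mathlib's scoped `L^∞`-operator normed algebra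
  `Matrix.Norms.Operator`, exactly as `Mathlib/Analysis/Normed/Algebra/MatrixExponential.lean` and
  the tree's `Literature/Analysis/Matrix/DetExp.lean` do (`backward.isDefEq.respectTransparency
  false` bridges the reducibly-different topology instances); statements carry no norm.
* Hall's "matrix Lie group" is a closed subgroup of `GL(n; ℂ)`; his proof of Thm. 3.20 uses only
  `1 ∈ H`, closure under products and topological closedness in `M_n(ℂ)` (the inverse of `e^{tX}`
  is `e^{−tX}`), which is the generality adopted (`Set.range r.ρ` is a compact submonoid).
* The scalar `(t : ℂ) • X` of the route and the real action `t • X` of `oneParamGenerators` agree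
  definitionally (Mathlib defines the real action on `ℂ` for this purpose), so no conversion
  lemma is needed between the route's inline span and `repLieAlgebra`.
* The commutator bracket on `M_n(ℂ)` is Mathlib's non-instance `LieRing.ofAssociativeRing`,
  enabled here (and in any file writing `LieSubalgebra ℝ (Matrix …)`) by
  `attribute [local instance 100] LieRing.ofAssociativeRing`, as in `Mathlib/Algebra/Lie/Matrix.lean`
  and the tree's `RealMatrixGroups.lean`; the `Submodule`-level API (`repLieAlgebra`,
  `mul_sub_mul_mem_repLieAlgebra`) needs no such attribute.
-/

noncomputable section

-- Mathlib idiom (Mathlib/Algebra/Lie/OfAssociative.lean): the commutator bracket on `M_n(ℂ)`.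
attribute [local instance 100] LieRing.ofAssociativeRing

open NormedSpace Filter Topology

namespace Literature.MathematicalPhysics.QuantumLattice

/-! ### The closed-subgroup theorem for `oneParamGenerators` / `matrixLieAlgebra` (Hall, Thm. 3.20) -/

section ClosedSubmonoid

variable {n : Type*} [Fintype n] [DecidableEq n]

/-- Powers stay in a submonoid given as a set. [folklore] -/
theorem pow_mem_of_mul_mem {H : Set (Matrix n n ℂ)} (h1 : (1 : Matrix n n ℂ) ∈ H)
    (hmul : ∀ a ∈ H, ∀ b ∈ H, a * b ∈ H) {a : Matrix n n ℂ} (ha : a ∈ H) (k : ℕ) : a ^ k ∈ H := by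
  induction k with
  | zero => simpa using h1
  | succ k ih => simpa [pow_succ] using hmul _ ih _ ha

/-- **Hall, Thm. 3.20 (1): `Ad`-stability.** If `X` generates a one-parameter subgroup of `H` and
`P, Q ∈ H` with `Q P = 1`, then so does `P X Q` (`e^{t PXQ} = P e^{tX} Q`). [cite: Hall2015, Theorem 3.20 (1)] -/
theorem conj_mem_oneParamGenerators {H : Set (Matrix n n ℂ)} (hmul : ∀ a ∈ H, ∀ b ∈ H, a * b ∈ H)
    {P Q X : Matrix n n ℂ} (hP : P ∈ H) (hQ : Q ∈ H) (hQP : Q * P = 1)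
    (hX : X ∈ oneParamGenerators H) : P * X * Q ∈ oneParamGenerators H := by
  intro t
  have hPQ : P * Q = 1 := mul_eq_one_comm.mp hQP
  have hu : IsUnit P :=
    (Matrix.isUnit_iff_isUnit_det P).mpr (Matrix.isUnit_det_of_right_inverse hPQ)
  have hinv : P⁻¹ = Q := Matrix.inv_eq_right_inv hPQ
  have hsmul : t • (P * X * Q) = P * (t • X) * P⁻¹ := by
    rw [hinv, Matrix.mul_smul, Matrix.smul_mul]
  rw [hsmul, Matrix.exp_conj _ _ hu, hinv]
  exact hmul _ (hmul _ hP _ (hX t)) _ hQ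

/-- **Hall, Thm. 3.20 (3): closure under addition**, by the Lie product formula
`e^{t(X+Y)} = lim_m (e^{tX/m} e^{tY/m})^m` (tree `lieTrotter_productFormula_holds`) and closedness
of `H`. [cite: Hall2015, Theorem 3.20 (3)] -/
theorem add_mem_oneParamGenerators {H : Set (Matrix n n ℂ)} (h1 : (1 : Matrix n n ℂ) ∈ H)
    (hmul : ∀ a ∈ H, ∀ b ∈ H, a * b ∈ H) (hH : IsClosed H) {X Y : Matrix n n ℂ}
    (hX : X ∈ oneParamGenerators H) (hY : Y ∈ oneParamGenerators H) :
    X + Y ∈ oneParamGenerators H := by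
  intro t
  have hlim := lieTrotter_productFormula_holds (𝕜 := ℂ) (n := n) (t • X) (t • Y)
  rw [← smul_add] at hlim
  refine hH.mem_of_tendsto hlim (Eventually.of_forall fun s => ?_)
  have hcast : ((s : ℕ) : ℂ)⁻¹ = (((s : ℝ)⁻¹ : ℝ) : ℂ) := by
    rw [Complex.ofReal_inv, Complex.ofReal_natCast]
  -- `((s : ℝ)⁻¹ : ℂ) • W = (s : ℝ)⁻¹ • W` holds by `rfl` (Mathlib's definition of the real action)
  have hsc : ∀ Z : Matrix n n ℂ, (s : ℂ)⁻¹ • (t • Z) = ((s : ℝ)⁻¹ * t) • Z := fun Z => by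
    rw [← smul_smul, hcast]
    rfl
  rw [hsc X, hsc Y]
  exact pow_mem_of_mul_mem h1 hmul (hmul _ (hX _) _ (hY _)) s

-- As in `Mathlib/Analysis/Normed/Algebra/MatrixExponential.lean` and `Literature/Analysis/Matrix/DetExp.lean`:
-- the scoped `L∞`-operator normed algebra structure on matrices is only reducibly-defeq to the Pi
-- uniformity, so `CompleteSpace` and the analytic facts about `exp` need this setting.
set_option backward.isDefEq.respectTransparency false in
open scoped Matrix.Norms.Operator in
/-- **The derivative of `Ad(e^{tX}) Y` at `t = 0` is the commutator**:
`d/dt (e^{tX} Y e^{−tX})|₀ = XY − YX` (product rule and `d/dt e^{tX} = X e^{tX} = e^{tX} X`).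
Hall, proof of Thm. 3.20 (4). [cite: Hall2015, Theorem 3.20 (4)] -/
theorem hasDerivAt_conj_exp_smul (X Y : Matrix n n ℂ) :
    HasDerivAt (fun s : ℝ => exp (s • X) * Y * exp (s • -X)) (X * Y - Y * X) 0 := by
  have h1 : HasDerivAt (fun s : ℝ => exp (s • X)) X 0 := by
    simpa using hasDerivAt_exp_smul_const' (𝕂 := ℝ) X (0 : ℝ)
  have h2 : HasDerivAt (fun s : ℝ => exp (s • -X)) (-X) 0 := by
    simpa using hasDerivAt_exp_smul_const (𝕂 := ℝ) (-X) (0 : ℝ)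
  have h3 : HasDerivAt (fun s : ℝ => exp (s • X) * Y) (X * Y) 0 := by
    simpa using h1.mul_const Y
  refine (h3.fun_mul h2).congr_deriv ?_
  simp only [zero_smul, exp_zero, mul_one, one_mul, mul_neg]
  abel

set_option backward.isDefEq.respectTransparency false in
open scoped Matrix.Norms.Operator in
/-- **Hall, Thm. 3.20 (4): the commutator of two generators lies in the Lie algebra.** For a
submonoid `H`, if `X, Y` generate one-parameter subgroups of `H` then `XY − YX ∈ matrixLieAlgebra H`:
`e^{sX} Y e^{−sX}` generates one (part (1)), so lies in the real span, which is a finite-dimensional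
hence closed subspace of `M_n(ℂ)`; the difference quotients at `s = 0` lie in it and converge to
`XY − YX`. [cite: Hall2015, Theorem 3.20 (4)] -/
theorem mul_sub_mul_mem_matrixLieAlgebra_of_mem_oneParamGenerators {H : Set (Matrix n n ℂ)}
    (hmul : ∀ a ∈ H, ∀ b ∈ H, a * b ∈ H) {X Y : Matrix n n ℂ}
    (hX : X ∈ oneParamGenerators H) (hY : Y ∈ oneParamGenerators H) :
    X * Y - Y * X ∈ matrixLieAlgebra H := by
  set γ : ℝ → Matrix n n ℂ := fun s => exp (s • X) * Y * exp (s • -X) with hγ_def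
  -- the curve lies in the span of the generators
  have hγmem : ∀ s, γ s ∈ (matrixLieAlgebra H : Set (Matrix n n ℂ)) := fun s => by
    refine mem_matrixLieAlgebra_of_mem (conj_mem_oneParamGenerators hmul (hX s) ?_ ?_ hY)
    · simpa only [smul_neg, neg_smul] using hX (-s)
    · rw [smul_neg, ← Matrix.exp_add_of_commute _ _ (Commute.neg_left (Commute.refl _)),
        neg_add_cancel, exp_zero]
  have hderiv : HasDerivAt γ (X * Y - Y * X) 0 := hasDerivAt_conj_exp_smul X Y
  have hclosed : IsClosed (matrixLieAlgebra H : Set (Matrix n n ℂ)) :=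
    Submodule.closed_of_finiteDimensional _
  refine hclosed.mem_of_tendsto hderiv.tendsto_slope (Eventually.of_forall fun s => ?_)
  rw [slope_def_module, sub_zero]
  exact Submodule.smul_mem _ _ (Submodule.sub_mem _ (hγmem s) (hγmem 0))

/-- **The span is the set (Hall, Thm. 3.20 (2)–(3)).** For a closed submonoid `H ⊆ M_n(ℂ)` the
generators of one-parameter subgroups already form a real subspace, so
`↑(matrixLieAlgebra H) = oneParamGenerators H`. [cite: Hall2015, Theorem 3.20 (2)–(3)] -/
theorem coe_matrixLieAlgebra_eq {H : Set (Matrix n n ℂ)} (h1 : (1 : Matrix n n ℂ) ∈ H)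
    (hmul : ∀ a ∈ H, ∀ b ∈ H, a * b ∈ H) (hH : IsClosed H) :
    (matrixLieAlgebra H : Set (Matrix n n ℂ)) = oneParamGenerators H := by
  refine Set.Subset.antisymm ?_ Submodule.subset_span
  let S : Submodule ℝ (Matrix n n ℂ) :=
    { carrier := oneParamGenerators H
      add_mem' := fun ha hb => add_mem_oneParamGenerators h1 hmul hH ha hb
      zero_mem' := zero_mem_oneParamGenerators h1
      smul_mem' := fun c _ hX => smul_mem_oneParamGenerators hX c }
  have hle : matrixLieAlgebra H ≤ S := Submodule.span_le.mpr fun _ hx => hx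
  exact fun _ hx => hle hx

/-- Membership in the Lie algebra of a closed submonoid `H`: `X ∈ matrixLieAlgebra H` iff
`e^{tX} ∈ H` for all real `t` (Hall, Def. 3.18 with Thm. 3.20). [cite: Hall2015, Definition 3.18 and Theorem 3.20] -/
theorem mem_matrixLieAlgebra_iff {H : Set (Matrix n n ℂ)} (h1 : (1 : Matrix n n ℂ) ∈ H)
    (hmul : ∀ a ∈ H, ∀ b ∈ H, a * b ∈ H) (hH : IsClosed H) {X : Matrix n n ℂ} :
    X ∈ matrixLieAlgebra H ↔ ∀ t : ℝ, exp (t • X) ∈ H := by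
  rw [← SetLike.mem_coe, coe_matrixLieAlgebra_eq h1 hmul hH]
  rfl

/-- `Ad`-stability of the Lie algebra of a closed submonoid: `P X Q ∈ 𝔤` for `X ∈ 𝔤`, `P, Q ∈ H`,
`Q P = 1` (Hall, Thm. 3.20 (1)). [cite: Hall2015, Theorem 3.20 (1)] -/
theorem conj_mem_matrixLieAlgebra {H : Set (Matrix n n ℂ)} (h1 : (1 : Matrix n n ℂ) ∈ H)
    (hmul : ∀ a ∈ H, ∀ b ∈ H, a * b ∈ H) (hH : IsClosed H) {P Q X : Matrix n n ℂ} (hP : P ∈ H)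
    (hQ : Q ∈ H) (hQP : Q * P = 1) (hX : X ∈ matrixLieAlgebra H) :
    P * X * Q ∈ matrixLieAlgebra H :=
  (mem_matrixLieAlgebra_iff h1 hmul hH).2
    (conj_mem_oneParamGenerators hmul hP hQ hQP ((mem_matrixLieAlgebra_iff h1 hmul hH).1 hX))

/-- **Hall, Thm. 3.20 (4)** for the Lie algebra of a closed submonoid: `XY − YX ∈ 𝔤` for
`X, Y ∈ 𝔤 = matrixLieAlgebra H`. [cite: Hall2015, Theorem 3.20 (4)] -/
theorem mul_sub_mul_mem_matrixLieAlgebra {H : Set (Matrix n n ℂ)} (h1 : (1 : Matrix n n ℂ) ∈ H)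
    (hmul : ∀ a ∈ H, ∀ b ∈ H, a * b ∈ H) (hH : IsClosed H) {X Y : Matrix n n ℂ}
    (hX : X ∈ matrixLieAlgebra H) (hY : Y ∈ matrixLieAlgebra H) :
    X * Y - Y * X ∈ matrixLieAlgebra H :=
  mul_sub_mul_mem_matrixLieAlgebra_of_mem_oneParamGenerators hmul
    ((mem_matrixLieAlgebra_iff h1 hmul hH).1 hX) ((mem_matrixLieAlgebra_iff h1 hmul hH).1 hY)

/-- **The Lie algebra of a closed submonoid `H ⊆ M_n(ℂ)` as a real Lie subalgebra of `𝔤𝔩(n, ℂ)`**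
(commutator bracket): the submodule `matrixLieAlgebra H` with Hall's Thm. 3.20 (4). For a compact
group `H ⊆ U(n)` this is the Lie algebra of the compact Lie group `H`. [cite: Hall2015, Definition 3.18 and Theorem 3.20] -/
def matrixLieSubalgebra (H : Set (Matrix n n ℂ)) (h1 : (1 : Matrix n n ℂ) ∈ H)
    (hmul : ∀ a ∈ H, ∀ b ∈ H, a * b ∈ H) (hH : IsClosed H) : LieSubalgebra ℝ (Matrix n n ℂ) :=
  { matrixLieAlgebra H with
    lie_mem' := fun {X Y} hX hY => by
      change X * Y - Y * X ∈ matrixLieAlgebra H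
      exact mul_sub_mul_mem_matrixLieAlgebra h1 hmul hH hX hY }

/-- The underlying submodule of `matrixLieSubalgebra H` is `matrixLieAlgebra H`. [folklore] -/
@[simp]
theorem matrixLieSubalgebra_toSubmodule (H : Set (Matrix n n ℂ)) (h1 : (1 : Matrix n n ℂ) ∈ H)
    (hmul : ∀ a ∈ H, ∀ b ∈ H, a * b ∈ H) (hH : IsClosed H) :
    (matrixLieSubalgebra H h1 hmul hH).toSubmodule = matrixLieAlgebra H := rfl

/-- Membership in `matrixLieSubalgebra H`: `e^{tX} ∈ H` for all real `t`. [cite: Hall2015, Definition 3.18] -/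
theorem mem_matrixLieSubalgebra_iff {H : Set (Matrix n n ℂ)} (h1 : (1 : Matrix n n ℂ) ∈ H)
    (hmul : ∀ a ∈ H, ∀ b ∈ H, a * b ∈ H) (hH : IsClosed H) {X : Matrix n n ℂ} :
    X ∈ matrixLieSubalgebra H h1 hmul hH ↔ ∀ t : ℝ, exp (t • X) ∈ H :=
  mem_matrixLieAlgebra_iff h1 hmul hH

/-! ### Inside `U(n)`: skew-Hermitian generators (Hall, Prop. 3.24) -/

set_option backward.isDefEq.respectTransparency false in
open scoped Matrix.Norms.Operator in
/-- **A one-parameter group determines its generator**: if `e^{tX} = e^{tY}` for all real `t` then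
`X = Y` (differentiate at `t = 0`). Hall, proof of Prop. 3.24 ("(3.9) holds for all real `t` iff
`X* = −X`"). [cite: Hall2015, Proposition 3.24 (proof)] -/
theorem eq_of_forall_exp_smul_eq {X Y : Matrix n n ℂ} (h : ∀ t : ℝ, exp (t • X) = exp (t • Y)) :
    X = Y := by
  have hX : HasDerivAt (fun t : ℝ => exp (t • X)) X 0 := by
    simpa using hasDerivAt_exp_smul_const' (𝕂 := ℝ) X (0 : ℝ)
  have hY : HasDerivAt (fun t : ℝ => exp (t • Y)) Y 0 := by
    simpa using hasDerivAt_exp_smul_const' (𝕂 := ℝ) Y (0 : ℝ)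
  rw [show (fun t : ℝ => exp (t • X)) = fun t => exp (t • Y) from funext h] at hX
  exact hX.unique hY

/-- **Hall, Prop. 3.24 (first half): generators of one-parameter subgroups of a subset of `U(n)`
are skew-Hermitian**: `(e^{tX})* = e^{tX*}` and `(e^{tX})⁻¹ = e^{−tX}` agree for all `t`, so
`X* = −X`. [cite: Hall2015, Proposition 3.24] -/
theorem star_eq_neg_of_mem_oneParamGenerators {H : Set (Matrix n n ℂ)}
    (hU : H ⊆ (Matrix.unitaryGroup n ℂ : Set (Matrix n n ℂ))) {X : Matrix n n ℂ}
    (hX : X ∈ oneParamGenerators H) : star X = -X := by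
  refine eq_of_forall_exp_smul_eq fun t => ?_
  have hmem : exp (t • X) ∈ Matrix.unitaryGroup n ℂ := hU (hX t)
  rw [show t • star X = star (t • X) by simp only [star_smul, star_trivial], ← star_exp,
    smul_neg, Matrix.exp_neg]
  exact (Matrix.inv_eq_left_inv (Unitary.star_mul_self_of_mem hmem)).symm

/-- The Lie algebra of any `H ⊆ U(n)` consists of skew-Hermitian matrices:
`matrixLieAlgebra H ≤ 𝔲(n)` (Mathlib's `skewAdjoint.submodule`). Hall, Prop. 3.24;
Bröcker–tom Dieck I (2.16). [cite: Hall2015, Proposition 3.24] [cite: BrockerTomDieck1985, I (2.16)] -/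
theorem matrixLieAlgebra_le_skewAdjoint {H : Set (Matrix n n ℂ)}
    (hU : H ⊆ (Matrix.unitaryGroup n ℂ : Set (Matrix n n ℂ))) :
    matrixLieAlgebra H ≤ skewAdjoint.submodule ℝ (Matrix n n ℂ) :=
  Submodule.span_le.mpr fun _ hX =>
    skewAdjoint.mem_iff.mpr (star_eq_neg_of_mem_oneParamGenerators hU hX)

end ClosedSubmonoid

/-! ### The Lie algebra of a lattice representation `r : LatticeRep G` -/

section LatticeRep

open Literature.MathematicalPhysics.QuantumFieldTheory (LatticeRep)
open Literature.NumberTheory.Automorphic (skewHermitianLie mem_skewHermitianLie_iff)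

variable {G : Type*} [Group G] [TopologicalSpace G]

/-- **The Lie algebra `𝔤_r ⊆ M_N(ℂ)` of the compact matrix group `r(G) ⊆ U(N)`** presented by a
lattice representation `r : LatticeRep G` (faithful continuous unitary `ρ : G →* M_N(ℂ)`): the tree's
`matrixLieAlgebra (Set.range r.ρ)`, i.e. the real span of `{X | e^{tX} ∈ r(G) ∀ t ∈ ℝ}` — equal to
that set (`mem_repLieAlgebra_iff`, `G` compact) and DEFINITIONALLY the inline
`Submodule.span ℝ {X | ∀ t : ℝ, exp ((t : ℂ) • X) ∈ Set.range r.ρ}` of route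
`EquipartitionCriticality` (`span_eq_repLieAlgebra`). Its real dimension is `dim G` (`n²` for
`U(n)`, `n² − 1` for `SU(n)`: `RepLieAlgebraUnitary.lean`). Hall, Def. 3.18; Bröcker–tom Dieck
I §2. [cite: Hall2015, Definition 3.18] -/
def repLieAlgebra (r : LatticeRep G) : Submodule ℝ (Matrix (Fin r.N) (Fin r.N) ℂ) :=
  matrixLieAlgebra (Set.range r.ρ)

/-- Unfolding: `repLieAlgebra r = matrixLieAlgebra (range r.ρ)`. [folklore] -/
theorem repLieAlgebra_def (r : LatticeRep G) :
    repLieAlgebra r = matrixLieAlgebra (Set.range r.ρ) := rfl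

/-- **The route's inline span IS `repLieAlgebra r`** (definitionally: `(t : ℂ) • X = t • X` by
`rfl`). [folklore] -/
theorem span_eq_repLieAlgebra (r : LatticeRep G) :
    Submodule.span ℝ {X : Matrix (Fin r.N) (Fin r.N) ℂ |
        ∀ t : ℝ, exp ((t : ℂ) • X) ∈ Set.range r.ρ} = repLieAlgebra r := rfl

/-- **The dimension in crux `FreeEnergyLogCoefficient` is `dim_ℝ 𝔤_r`**:
`finrank ℝ (span ℝ {X | ∀ t, exp ((t : ℂ) • X) ∈ range r.ρ}) = finrank ℝ (repLieAlgebra r)`. [folklore] -/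
theorem finrank_span_eq_finrank_repLieAlgebra (r : LatticeRep G) :
    Module.finrank ℝ
        ↥(Submodule.span ℝ {X : Matrix (Fin r.N) (Fin r.N) ℂ |
            ∀ t : ℝ, NormedSpace.exp ((t : ℂ) • X) ∈ Set.range r.ρ}) =
      Module.finrank ℝ (repLieAlgebra r) := rfl

/-- `𝔤_r` is finite-dimensional over `ℝ` (a subspace of `M_N(ℂ) ≅ ℝ^{2N²}`). [folklore] -/
instance repLieAlgebra.finiteDimensional (r : LatticeRep G) :
    FiniteDimensional ℝ (repLieAlgebra r) := by
  unfold repLieAlgebra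
  infer_instance

/-- `1 = r(1) ∈ r(G)`. [folklore] -/
theorem _root_.Literature.MathematicalPhysics.QuantumFieldTheory.LatticeRep.one_mem_range (r : LatticeRep G) :
    (1 : Matrix (Fin r.N) (Fin r.N) ℂ) ∈ Set.range r.ρ :=
  ⟨1, map_one r.ρ⟩

/-- `r(G)` is closed under products. [folklore] -/
theorem _root_.Literature.MathematicalPhysics.QuantumFieldTheory.LatticeRep.mul_mem_range (r : LatticeRep G) :
    ∀ a ∈ Set.range r.ρ, ∀ b ∈ Set.range r.ρ, a * b ∈ Set.range r.ρ := by
  rintro _ ⟨a, rfl⟩ _ ⟨b, rfl⟩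
  exact ⟨a * b, map_mul r.ρ a b⟩

/-- `r(G) ⊆ U(N)`. [folklore] -/
theorem _root_.Literature.MathematicalPhysics.QuantumFieldTheory.LatticeRep.range_subset_unitaryGroup (r : LatticeRep G) :
    Set.range r.ρ ⊆ (Matrix.unitaryGroup (Fin r.N) ℂ : Set (Matrix (Fin r.N) (Fin r.N) ℂ)) := by
  rintro _ ⟨g, rfl⟩
  exact r.mem_unitary g

/-- For compact `G`, `r(G)` is compact, hence closed in `M_N(ℂ)`. [folklore] -/
theorem _root_.Literature.MathematicalPhysics.QuantumFieldTheory.LatticeRep.isClosed_range [CompactSpace G]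
    (r : LatticeRep G) : IsClosed (Set.range r.ρ) :=
  (isCompact_range r.continuous).isClosed

/-- **`𝔤_r ⊆ 𝔲(N)`**: the Lie algebra of a unitary representation consists of skew-Hermitian
matrices. Hall, Prop. 3.24; Bröcker–tom Dieck I (2.16). [cite: Hall2015, Proposition 3.24] -/
theorem repLieAlgebra_le_skewAdjoint (r : LatticeRep G) :
    repLieAlgebra r ≤ skewAdjoint.submodule ℝ (Matrix (Fin r.N) (Fin r.N) ℂ) :=
  matrixLieAlgebra_le_skewAdjoint r.range_subset_unitaryGroup

variable [CompactSpace G]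

/-- **Membership (closed-subgroup theorem for `r(G)`)**: for compact `G`,
`X ∈ 𝔤_r ↔ e^{tX} ∈ r(G)` for all real `t` — the span adds nothing. Hall, Def. 3.18 and
Thm. 3.20. [cite: Hall2015, Theorem 3.20] -/
theorem mem_repLieAlgebra_iff (r : LatticeRep G) {X : Matrix (Fin r.N) (Fin r.N) ℂ} :
    X ∈ repLieAlgebra r ↔ ∀ t : ℝ, exp ((t : ℂ) • X) ∈ Set.range r.ρ :=
  mem_matrixLieAlgebra_iff r.one_mem_range r.mul_mem_range r.isClosed_range

/-- The carrier of `𝔤_r` is the route's set `{X | ∀ t, exp ((t : ℂ) • X) ∈ range r.ρ}`. [cite: Hall2015, Theorem 3.20] -/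
theorem coe_repLieAlgebra (r : LatticeRep G) :
    (repLieAlgebra r : Set (Matrix (Fin r.N) (Fin r.N) ℂ)) =
      {X | ∀ t : ℝ, exp ((t : ℂ) • X) ∈ Set.range r.ρ} :=
  coe_matrixLieAlgebra_eq r.one_mem_range r.mul_mem_range r.isClosed_range

/-- **`Ad`-invariance**: `r(g) X r(g)⁻¹ = r(g) X r(g⁻¹) ∈ 𝔤_r` for `X ∈ 𝔤_r`. Hall, Thm. 3.20 (1);
Bröcker–tom Dieck I (2.20). [cite: Hall2015, Theorem 3.20 (1)] -/
theorem conj_mem_repLieAlgebra (r : LatticeRep G) (g : G) {X : Matrix (Fin r.N) (Fin r.N) ℂ}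
    (hX : X ∈ repLieAlgebra r) : r.ρ g * X * r.ρ g⁻¹ ∈ repLieAlgebra r :=
  conj_mem_matrixLieAlgebra r.one_mem_range r.mul_mem_range r.isClosed_range ⟨g, rfl⟩
    ⟨g⁻¹, rfl⟩ (by rw [← map_mul, inv_mul_cancel, map_one]) hX

/-- **The bracket closes**: `XY − YX ∈ 𝔤_r` for `X, Y ∈ 𝔤_r`. Hall, Thm. 3.20 (4). [cite: Hall2015, Theorem 3.20 (4)] -/
theorem mul_sub_mul_mem_repLieAlgebra (r : LatticeRep G) {X Y : Matrix (Fin r.N) (Fin r.N) ℂ}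
    (hX : X ∈ repLieAlgebra r) (hY : Y ∈ repLieAlgebra r) : X * Y - Y * X ∈ repLieAlgebra r :=
  mul_sub_mul_mem_matrixLieAlgebra r.one_mem_range r.mul_mem_range r.isClosed_range hX hY

/-- **The Lie algebra of `r(G)` as a real Lie subalgebra of `𝔤𝔩(N, ℂ)`** (commutator bracket),
with underlying submodule `repLieAlgebra r`: the Lie algebra of the compact Lie group
`r(G) ≅ G`. As in Mathlib (`Mathlib/Algebra/Lie/Matrix.lean`) the commutator `LieRing` structure on
matrices is the non-instance `LieRing.ofAssociativeRing`: a file that WRITES the type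
`LieSubalgebra ℝ (Matrix …)` enables it with `attribute [local instance 100] LieRing.ofAssociativeRing`.
Hall, Def. 3.18 and Thm. 3.20; Bröcker–tom Dieck I §2. [cite: Hall2015, Theorem 3.20] -/
def repLieSubalgebra (r : LatticeRep G) : LieSubalgebra ℝ (Matrix (Fin r.N) (Fin r.N) ℂ) :=
  matrixLieSubalgebra (Set.range r.ρ) r.one_mem_range r.mul_mem_range r.isClosed_range

/-- The underlying submodule of `repLieSubalgebra r` is `repLieAlgebra r`. [folklore] -/
@[simp]
theorem repLieSubalgebra_toSubmodule (r : LatticeRep G) :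
    (repLieSubalgebra r).toSubmodule = repLieAlgebra r := rfl

/-- Membership in `repLieSubalgebra r` is membership in `repLieAlgebra r`. [folklore] -/
@[simp]
theorem mem_repLieSubalgebra_iff (r : LatticeRep G) {X : Matrix (Fin r.N) (Fin r.N) ℂ} :
    X ∈ repLieSubalgebra r ↔ X ∈ repLieAlgebra r := Iff.rfl

/-- The real dimension of the Lie subalgebra is that of `repLieAlgebra r`. [folklore] -/
theorem finrank_repLieSubalgebra (r : LatticeRep G) :
    Module.finrank ℝ (repLieSubalgebra r) = Module.finrank ℝ (repLieAlgebra r) := rfl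

/-- **`𝔤_r ≤ 𝔲(N)` as Lie subalgebras** (the tree's `skewHermitianLie ℂ (Fin N)` of
`RealMatrixGroups.lean`, carrier `skewAdjoint`). Hall, Prop. 3.24. [cite: Hall2015, Proposition 3.24] -/
theorem repLieSubalgebra_le_skewHermitianLie (r : LatticeRep G) :
    repLieSubalgebra r ≤ skewHermitianLie ℂ (Fin r.N) := fun _ hX =>
  (mem_skewHermitianLie_iff _).2 (skewAdjoint.mem_iff.1 (repLieAlgebra_le_skewAdjoint r hX))

end LatticeRep

end Literature.MathematicalPhysics.QuantumLattice

end
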